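import Summits.QuantumFields.YangMills.Theorems.F4SubCurvatureDoorShortRootRigidityPlanarStepFrames
import Mathlib
import HarnessLib

/-!
# LINE g21-C «aperture bootstrap» (crux ⟨stmt-QuantumFields-23035⟩ `F4SubCurvatureDoor.ShortRootRigidity`), THE STEP R-S3d — FILE 2,
# part B: the `ε`-shift with its UNIFORM bound (STUB-PLAN H4) and the edge geometry at `z⋆ = (t, iτt)` (H5)

* H4: `G0 μ z = F0 μ (z + (1,0))`, `Gplus μ z = Fplus μ (z + (1,0))`, holomorphic on `T0 τ` / `Tplus τ`, with the UNIFORM bound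
  `k(1/2, 0)` (`norm_G0_le`, `norm_Gplus_le`: the shift raises the margins by `τ` resp. `τ/2` since `u₀·u₊ = 1/2 > 0` and `u₀·u₊^⊥` is real;
  antitonicity of the axis function); `G0_eq_Gplus` on `T0 ∩ Tplus` from `FrameAgreement`; evenness `G0_neg_snd`.
* H5: the flat functionals `l0 τ = (iτ, −1)`, `lplus τ = (√3/2 + iτ/2, −1/2 + iτ√3/2)` as `(ℂ × ℂ) →L[ℂ] ℂ` — `im_l0`, `im_lplus`
  (their imaginary parts ARE the two tube margins), `linearIndependent_l0_lplus` for `0 < τ < 1` (`det = (√3/2)(1 − τ²)`), the edge point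
  `zstar τ t = (t, iτt)` where both margins vanish (`im_l0_zstar`, `im_lplus_zstar`), and the ball lemmas `mem_T0_of_ball`,
  `mem_Tplus_of_ball`: inside `‖z − z⋆‖ < τt/3` (MAX norm of `ℂ × ℂ`; `(√3 + 1)/6 < 1/2`) positivity of `Im l₀(z − z⋆)` resp.
  `Im l₊(z − z⋆)` puts `z` in `T0 τ` resp. `Tplus τ` — the second boundary sheets stay inactive.

HONEST LABEL: helper toward the OPEN stub :137 of an OPEN line; no stub is closed here; (C), ⟨23035⟩, ⟨23125⟩, R2d and the
Yang–Mills mass gap remain OPEN; no summit is proved by a line.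
-/

noncomputable section

namespace Summit.QuantumFields.YangMills.Theorems.F4SubCurvatureDoorPlanarApertureStepRegistered

open MeasureTheory Filter Topology Set Metric Complex
open scoped BigOperators NNReal ENNReal
open Summit.QuantumFields.YangMills.Theorems.F4SubCurvatureDoorSliceDensityRegistered (E2)
open Summit.QuantumFields.YangMills.Theorems.F4SubCurvatureDoorSliceInClassRegistered (InPlanarClass)
open Summit.QuantumFields.YangMills.Cruxes.ShortRootRigidity.AngularType (mk2)
open Summit.QuantumFields.YangMills.Theorems.F4SubCurvatureDoorConePackagingRegistered (IsPlanarLF HasAperture)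

variable {k : E2 → ℝ} {μ : Measure (ℝ × ℝ)} {τ : ℝ}

/-! ## H4: the `ε`-shift (`ε = 1`) and the uniform bound `M = k(1/2, 0)` -/

/-- `G₀(z) = F₀(z + (1, 0))`. -/
def G0 (μ : Measure (ℝ × ℝ)) (z : ℂ × ℂ) : ℂ := F0 μ (z + ((1 : ℂ), (0 : ℂ)))

/-- `G₊(z) = F₊(z + (1, 0))`. -/
def Gplus (μ : Measure (ℝ × ℝ)) (z : ℂ × ℂ) : ℂ := Fplus μ (z + ((1 : ℂ), (0 : ℂ)))

/-- `G₀` is holomorphic on `T₀`. -/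
theorem differentiableOn_G0 (hLF : IsPlanarLF k μ) (hap : HasAperture μ τ) (hτ : 0 < τ) :
    DifferentiableOn ℂ (G0 μ) (T0 τ) :=
  (differentiableOn_F0 hLF hap hτ).comp (by fun_prop : Differentiable ℂ fun z : ℂ × ℂ => z + ((1 : ℂ), (0 : ℂ))).differentiableOn
    fun _ hz => add_one_mem_T0 hτ.le hz

/-- `G₊` is holomorphic on `T₊`. -/
theorem differentiableOn_Gplus (hLF : IsPlanarLF k μ) (hap : HasAperture μ τ) (hτ : 0 < τ) :
    DifferentiableOn ℂ (Gplus μ) (Tplus τ) :=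
  (differentiableOn_Fplus hLF hap hτ).comp
    (by fun_prop : Differentiable ℂ fun z : ℂ × ℂ => z + ((1 : ℂ), (0 : ℂ))).differentiableOn fun _ hz => add_one_mem_Tplus hτ.le hz

/-- **The uniform bound on `T₀`:** `‖G₀‖ ≤ k(1/2, 0)`. -/
theorem norm_G0_le (hLF : IsPlanarLF k μ) (hap : HasAperture μ τ) (hτ : 0 < τ) {z : ℂ × ℂ} (hz : z ∈ T0 τ) :
    ‖G0 μ z‖ ≤ k (mk2 (1 / 2) 0) := by
  have hz' : |z.2.im| < τ * z.1.re := hz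
  have h1 := norm_F0_le hLF hap hτ (add_one_mem_T0 hτ.le hz)
  refine h1.trans (k_axis_antitone hLF (by norm_num) ?_)
  simp only [Prod.fst_add, Prod.snd_add, add_re, one_re, add_zero]
  have : |z.2.im| / τ < z.1.re := by rw [div_lt_iff₀ hτ]; linarith
  linarith

/-- **The uniform bound on `T₊`:** `‖G₊‖ ≤ k(1/2, 0)`. -/
theorem norm_Gplus_le (hLF : IsPlanarLF k μ) (hap : HasAperture μ τ) (hτ : 0 < τ) {z : ℂ × ℂ} (hz : z ∈ Tplus τ) :
    ‖Gplus μ z‖ ≤ k (mk2 (1 / 2) 0) := by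
  have hz' : |(dotUperp z).im| < τ * (dotU z).re := hz
  have h1 := norm_Fplus_le hLF hap hτ (add_one_mem_Tplus hτ.le hz)
  refine h1.trans (k_axis_antitone hLF (by norm_num) ?_)
  simp only [dotU_re, dotUperp_im, Prod.fst_add, Prod.snd_add, add_re, one_re, add_im, one_im, add_zero]
  have h2 : |(dotUperp z).im| / τ < (dotU z).re := by rw [div_lt_iff₀ hτ]; linarith
  rw [dotU_re, dotUperp_im] at h2
  linarith

/-- `G₀ = G₊` on `T₀ ∩ T₊`, given the frame agreement. -/
theorem G0_eq_Gplus (hA : FrameAgreement τ) (hk : InPlanarClass k) (hLF : IsPlanarLF k μ) (hap : HasAperture μ τ)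
    (hτ : 0 < τ) {z : ℂ × ℂ} (hz0 : z ∈ T0 τ) (hzp : z ∈ Tplus τ) : G0 μ z = Gplus μ z :=
  hA k μ hk hLF hap ⟨add_one_mem_T0 hτ.le hz0, add_one_mem_Tplus hτ.le hzp⟩

/-- `G₀` is even in `β`. -/
theorem G0_neg_snd (μ : Measure (ℝ × ℝ)) (ζ β : ℂ) : G0 μ (ζ, -β) = G0 μ (ζ, β) := by
  simp only [G0, Prod.mk_add_mk, add_zero]
  exact F0_neg_snd μ _ _

/-! ## H5: the edge point `z⋆ = (t, iτt)` and the two flat functionals -/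

/-- `l₀(ζ, β) = iτζ − β`, so that `Im l₀(w) = τ Re ζ − Im β`. -/
def l0 (τ : ℝ) : (ℂ × ℂ) →L[ℂ] ℂ :=
  (I * (τ : ℂ)) • ContinuousLinearMap.fst ℂ ℂ ℂ - ContinuousLinearMap.snd ℂ ℂ ℂ

/-- `l₊(ζ, β) = (√3/2 + iτ/2)ζ + (−1/2 + iτ√3/2)β`, so that `Im l₊(w) = τ Re(w·u₊) − Im(w·u₊^⊥)`. -/
def lplus (τ : ℝ) : (ℂ × ℂ) →L[ℂ] ℂ :=
  (((Real.sqrt 3 / 2 : ℝ) : ℂ) + I * ((τ / 2 : ℝ) : ℂ)) • ContinuousLinearMap.fst ℂ ℂ ℂ +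
    (((-(1 / 2) : ℝ) : ℂ) + I * ((τ * Real.sqrt 3 / 2 : ℝ) : ℂ)) • ContinuousLinearMap.snd ℂ ℂ ℂ

/-- Evaluation of `l₀`. -/
theorem l0_apply (τ : ℝ) (w : ℂ × ℂ) : l0 τ w = I * (τ : ℂ) * w.1 - w.2 := by
  simp [l0]

/-- Evaluation of `l₊`. -/
theorem lplus_apply (τ : ℝ) (w : ℂ × ℂ) :
    lplus τ w = (((Real.sqrt 3 / 2 : ℝ) : ℂ) + I * ((τ / 2 : ℝ) : ℂ)) * w.1 +
      (((-(1 / 2) : ℝ) : ℂ) + I * ((τ * Real.sqrt 3 / 2 : ℝ) : ℂ)) * w.2 := by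
  simp [lplus]

/-- `Im l₀(w) = τ Re ζ − Im β` — the `T₀`-margin. -/
theorem im_l0 (τ : ℝ) (w : ℂ × ℂ) : (l0 τ w).im = τ * w.1.re - w.2.im := by
  rw [l0_apply]; simp

/-- `Im l₊(w) = τ Re(w·u₊) − Im(w·u₊^⊥)` — the `T₊`-margin. -/
theorem im_lplus (τ : ℝ) (w : ℂ × ℂ) : (lplus τ w).im = τ * (dotU w).re - (dotUperp w).im := by
  rw [lplus_apply, dotU_re, dotUperp_im]
  simp only [add_im, mul_im, add_re, ofReal_re, mul_re, I_re, zero_mul, I_im, ofReal_im, mul_zero, sub_zero, one_mul,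
    zero_add, add_zero]
  ring

/-- `l₀, l₊` are ℂ-independent for `τ² ≠ 1` (`det = (√3/2)(1 − τ²)`). -/
theorem linearIndependent_l0_lplus {τ : ℝ} (hτ : 0 < τ) (hτ1 : τ < 1) : LinearIndependent ℂ ![l0 τ, lplus τ] := by
  rw [LinearIndependent.pair_iff]
  intro s t hst
  have h1 := congrArg (fun f : (ℂ × ℂ) →L[ℂ] ℂ => f ((1 : ℂ), (0 : ℂ))) hst
  have h2 := congrArg (fun f : (ℂ × ℂ) →L[ℂ] ℂ => f ((0 : ℂ), (1 : ℂ))) hst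
  simp only [add_apply, FunLike.coe_smul, Pi.smul_apply, l0_apply, lplus_apply,
    smul_eq_mul, mul_one, mul_zero, sub_zero, add_zero, zero_sub, zero_add, zero_apply] at h1 h2
  -- h2 : s * (-1) + t * b = 0, h1 : s * (Iτ) + t * a = 0
  have hs : s = t * (((-(1 / 2) : ℝ) : ℂ) + I * ((τ * Real.sqrt 3 / 2 : ℝ) : ℂ)) := by
    linear_combination -h2
  rw [hs] at h1
  -- h1 : t * (det) = 0 with det = (√3/2)(1 - τ²) as a complex number
  have hdet : (((-(1 / 2) : ℝ) : ℂ) + I * ((τ * Real.sqrt 3 / 2 : ℝ) : ℂ)) * (I * (τ : ℂ)) +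
      (((Real.sqrt 3 / 2 : ℝ) : ℂ) + I * ((τ / 2 : ℝ) : ℂ)) = ((Real.sqrt 3 / 2 * (1 - τ ^ 2) : ℝ) : ℂ) := by
    push_cast
    ring_nf
    rw [Complex.I_sq]
    ring
  have h1' : t * ((Real.sqrt 3 / 2 * (1 - τ ^ 2) : ℝ) : ℂ) = 0 := by
    rw [← hdet]; linear_combination h1
  have hne : ((Real.sqrt 3 / 2 * (1 - τ ^ 2) : ℝ) : ℂ) ≠ 0 := by
    rw [Complex.ofReal_ne_zero]
    have : 0 < 1 - τ ^ 2 := by nlinarith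
    exact (mul_pos (by positivity) this).ne'
  have ht : t = 0 := by
    rcases mul_eq_zero.mp h1' with h | h
    · exact h
    · exact absurd h hne
  refine ⟨?_, ht⟩
  rw [hs, ht, zero_mul]

/-- The edge point `z⋆(t) = (t, iτt)`. -/
def zstar (τ t : ℝ) : ℂ × ℂ := ((t : ℂ), I * ((τ * t : ℝ) : ℂ))

/-- First coordinate of the edge point. -/
@[simp] theorem zstar_fst (τ t : ℝ) : (zstar τ t).1 = (t : ℂ) := rfl
/-- Second coordinate of the edge point. -/
@[simp] theorem zstar_snd (τ t : ℝ) : (zstar τ t).2 = I * ((τ * t : ℝ) : ℂ) := rfl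

/-- `Im (z⋆).2 = τt`. -/
theorem zstar_snd_im (τ t : ℝ) : (zstar τ t).2.im = τ * t := by simp
/-- `Re (z⋆).2 = 0`. -/
theorem zstar_snd_re (τ t : ℝ) : (zstar τ t).2.re = 0 := by simp
/-- `Re (z⋆).1 = t`. -/
theorem zstar_fst_re (τ t : ℝ) : (zstar τ t).1.re = t := by simp
/-- `Im (z⋆).1 = 0`. -/
theorem zstar_fst_im (τ t : ℝ) : (zstar τ t).1.im = 0 := by simp

/-- `Im l₊` vanishes at the edge point: `τ Re(z⋆·u₊) = Im(z⋆·u₊^⊥) = τt/2`. -/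
theorem im_lplus_zstar (τ t : ℝ) : (lplus τ (zstar τ t)).im = 0 := by
  rw [im_lplus, dotU_re, dotUperp_im, zstar_fst_re, zstar_snd_re, zstar_fst_im, zstar_snd_im]; ring

/-- `Im l₀` vanishes at the edge point. -/
theorem im_l0_zstar (τ t : ℝ) : (l0 τ (zstar τ t)).im = 0 := by
  rw [im_l0, zstar_fst_re, zstar_snd_im]; ring

/-- **H5 (ii), frame 0:** inside the ball `‖z − z⋆‖ < τt/3`, `Im l₀(z − z⋆) > 0 ⇒ z ∈ T₀`. -/
theorem mem_T0_of_ball {τ t : ℝ} (hτ : 0 < τ) (ht : 0 < t) {z : ℂ × ℂ} (hz : ‖z - zstar τ t‖ < τ * t / 3)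
    (hl : 0 < (l0 τ (z - zstar τ t)).im) : z ∈ T0 τ := by
  have him : |(z - zstar τ t).2.im| ≤ ‖z - zstar τ t‖ := (Complex.abs_im_le_norm _).trans (norm_snd_le _)
  rw [Prod.snd_sub, sub_im, zstar_snd_im] at him
  have hpos : 0 < z.2.im := by
    have := (abs_le.mp (him.trans hz.le)).1
    nlinarith
  rw [map_sub, sub_im, im_l0_zstar, sub_zero, im_l0] at hl
  show |z.2.im| < τ * z.1.re
  rw [abs_of_pos hpos]; linarith

/-- **H5 (ii), frame +:** inside the ball `‖z − z⋆‖ < τt/3`, `Im l₊(z − z⋆) > 0 ⇒ z ∈ T₊` (uses `(√3 + 1)/6 < 1/2`). -/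
theorem mem_Tplus_of_ball {τ t : ℝ} (hτ : 0 < τ) (ht : 0 < t) {z : ℂ × ℂ} (hz : ‖z - zstar τ t‖ < τ * t / 3)
    (hl : 0 < (lplus τ (z - zstar τ t)).im) : z ∈ Tplus τ := by
  have him2 : |(z - zstar τ t).2.im| ≤ ‖z - zstar τ t‖ := (Complex.abs_im_le_norm _).trans (norm_snd_le _)
  have him1 : |(z - zstar τ t).1.im| ≤ ‖z - zstar τ t‖ := (Complex.abs_im_le_norm _).trans (norm_fst_le _)
  rw [Prod.snd_sub, sub_im, zstar_snd_im] at him2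
  rw [Prod.fst_sub, sub_im, zstar_fst_im, sub_zero] at him1
  have h2 := abs_le.mp (him2.trans hz.le)
  have h1 := abs_le.mp (him1.trans hz.le)
  have hpos : 0 < (dotUperp z).im := by
    rw [dotUperp_im]
    have h3pos : 0 < Real.sqrt 3 := Real.sqrt_pos.2 (by norm_num)
    have h3lt : Real.sqrt 3 < 2 := by
      rw [show (2 : ℝ) = Real.sqrt 4 by rw [show (4 : ℝ) = 2 ^ 2 by norm_num, Real.sqrt_sq (by norm_num)]]
      exact Real.sqrt_lt_sqrt (by norm_num) (by norm_num)
    have hA : Real.sqrt 3 / 2 * z.1.im ≤ Real.sqrt 3 / 2 * (τ * t / 3) :=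
      mul_le_mul_of_nonneg_left h1.2 (half_pos h3pos).le
    have hB : Real.sqrt 3 / 2 * (τ * t / 3) < τ * t / 3 := by
      have hτt : 0 < τ * t / 3 := by positivity
      nlinarith
    linarith [h2.1]
  rw [map_sub, sub_im, im_lplus_zstar, sub_zero, im_lplus] at hl
  show |(dotUperp z).im| < τ * (dotU z).re
  rw [abs_of_pos hpos]; linarith

end Summit.QuantumFields.YangMills.Theorems.F4SubCurvatureDoorPlanarApertureStepRegistered

end
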